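import Summits.QuantumAdvantage.AdviceFreeQNC0.AffBells29Peeling
import Summits.QuantumAdvantage.AdviceFreeQNC0.AffBells23RingCondProofs
import HarnessLib

/-!
# Frame-shadow reduction — part 1/3: §S.1 wide rows and the shadow strategy, §S.2 the shadow is a log-junta and loses, §S.3 the conjecture `HWide`

VERBATIM split (400-line rule) of planner qa-qnc0-p1 g29's `HOME/qa-qnc0-p1/exp29/Shadow29.lean` (sha16 `0a7e49ebba69860e`, 872 lines, farm
rc 0 / 0 sorry / 0 warnings, axioms standard; authored AND proved by the planner seat; landed by qn-prover-3 g15, ask P-29h) into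
`AffBells29Shadow.lean` (§S.1–§S.3), `AffBells29Transfer.lean` (§S.4–§S.6), `AffBells29Shape.lean` (§S.7); only the file boundaries, the
per-file preambles, these header lines and one-line docstrings on undocumented auxiliaries are new.  The planner's module docstring follows.

# Sketch29 / Shadow29 (planner qn-p1 g29, ROUND-28 rev. 3 §6(b)(S3′)(ii), ask P-29h): the FRAME-SHADOW REDUCTION — typed and PROVED

The pure regime (`HPure`, regime II of ROUND-28 §6) reduces to ONE conjecture about WIDE rows.  Fix a width `w`
(think `w = C·log₂ N`).  A row `b` of the affine strategy `(β, c)` is WIDE if `|supp β_b| > w`, NARROW otherwise.  The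
`w`-SHADOW `(shadowRow w β, shadowOff w β c)` keeps every narrow row and replaces every wide row by the zero row with offset
`0` — a bell that ALWAYS fires.  Two facts, both PROVED here:

* `shadow_pointwise` / `shadow_count` (bookkeeping on `targetFormula`): at an odd point `x` where the WIDE ACTIVE rows fire with
  parity `≡` their number (`WideParityAt w β c x`), the strategy and its shadow win or lose TOGETHER; hence
  `affWinCard β c ≤ affWinCard (shadow) + #{x odd : ¬ WideParityAt w β c x}`.
* `juntaLogHard` / `shadow_loses` (from the TREE theorem `AffBells23.ringHardOddCond2`, δ₀ = 0, degree exponent 2): a strategy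
  whose every output bit reads `≤ C·log₂ N` input bits wins on at most `θ·2^{N−1}` odd inputs, ONE absolute `θ < 1` for all `C`;
  the `w`-shadow with `w ≤ C log₂ N` is such a strategy (`readsOnly_shadow`).

Consequently (`shadow_bound`): `affWinCard β c ≤ θ·2^{N−1} + #{x odd : ¬ WideParityAt w β c x}` for EVERY `(β, c)` and every
`w ≤ C log₂ N`, `N ≥ n₀(C)`.  The remaining conjecture of the (NP₁) programme is therefore the typed statement `HWide` below
(«far from frames ∧ few pair-cut points ⇒ wide parity fails on an o(1) fraction of the odd class»), and the WHOLE glue is PROVED here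
without window laws: `polyLoss_of_hWide : HWide → AffBellsPolyLoss3` (§S.5) — frames by the tree's `AffBells27.affFrameLoss`, regime I
(many cut points) by the elementary double count `cutPoints_le` (§S.4: a cut point is a loser or one pair flip from one), regime II by
`HWide` + `shadow_bound`.  §S.6 adds the general TRANSFER PRINCIPLE (`transfer_pointwise/count/bound`, `degHard`: the ring relation sees a strategy only through
the parity of its ACTIVE answer bits, so ANY polylog-degree strategy agreeing with `(β, c)` in active parity a.e. bounds `affWinCard`) and the weaker
conjecture `HAbs` with `hAbs_of_hWide : HWide → HAbs` and `polyLoss_of_hAbs : HAbs → AffBellsPolyLoss3` (PROVED).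
Why `HWide` should hold (ROUND-28 §6(b) T1–T5, §6A): balanced proportionality classes fire `≡ |class|`; the free-phase lemma
(`AffBells29.freePhase_parity`, Expansion29), the subspace / Fourier / ANF-tower lemmas and the single-deletion argument say
window-purity forces the wide classes to be balanced except on near-twin clusters, which far-ness and activity variation kill;
wide rows blind or 1-thin on the coins of `x` are `N^{1−cC}`-rare.

WHAT THIS IS NOT: no claim about the crux `RingDenseResidualLt3`; `HWide` is a conjecture (typed, unproved); separation NOT moved.
-/

noncomputable section

open Classical

namespace Summit.QuantumAdvantage.AdviceFreeQNC0

namespace AffBells29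

open Finset Literature.Computability.QuantumComplexity Literature.Computability.QuantumComplexity.RingHLF
open Literature.Computability.MetaComplexity Literature.Computability.MetaComplexity.Smolensky
open AffBells23 AffBells26 Fib19 AffBells27 AffBells28

variable {N : ℕ}


/-! ### §S.1 Wide rows and the shadow strategy -/

/-- The support of row `b`. -/
def rowSupp (β : Fin N → Fin N → ZMod 3) (b : Fin N) : Finset (Fin N) := univ.filter fun i => β b i ≠ 0

/-- The `w`-SHADOW of `β`: rows of support `> w` (WIDE rows) become the zero row. -/
def shadowRow (w : ℕ) (β : Fin N → Fin N → ZMod 3) : Fin N → Fin N → ZMod 3 :=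
  fun b i => if w < (rowSupp β b).card then 0 else β b i

/-- The offsets of the `w`-shadow: wide rows get offset `0` (so the zero row ALWAYS fires), narrow rows keep `c_b`. -/
def shadowOff (w : ℕ) (β : Fin N → Fin N → ZMod 3) (c : Fin N → ZMod 3) : Fin N → ZMod 3 :=
  fun b => if w < (rowSupp β b).card then 0 else c b

/-- The WIDE ACTIVE rows at `x`. -/
def wideAct (w : ℕ) (β : Fin N → Fin N → ZMod 3) (x : Fin N → Bool) : Finset (Fin N) :=
  (act x).filter fun g => w < (rowSupp β g).card

/-- **WIDE PARITY at `x`**: the wide active rows fire with parity `≡` their number (what BALANCED wide classes give). -/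
def WideParityAt (w : ℕ) (β : Fin N → Fin N → ZMod 3) (c : Fin N → ZMod 3) (x : Fin N → Bool) : Prop :=
  fires β c (wideAct w β x) x % 2 = (wideAct w β x).card % 2

/-- Auxiliary `form_shadow_wide` of the frame-shadow reduction (planner qa-qnc0-p1 g29, `Shadow29.lean`, verbatim). -/
theorem form_shadow_wide (w : ℕ) (β : Fin N → Fin N → ZMod 3) (x : Fin N → Bool) {b : Fin N} (hb : w < (rowSupp β b).card) :
    form (shadowRow w β) x b = 0 := by
  unfold form shadowRow
  simp [hb]

/-- Auxiliary `form_shadow_narrow` of the frame-shadow reduction (planner qa-qnc0-p1 g29, `Shadow29.lean`, verbatim). -/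
theorem form_shadow_narrow (w : ℕ) (β : Fin N → Fin N → ZMod 3) (x : Fin N → Bool) {b : Fin N} (hb : ¬ w < (rowSupp β b).card) :
    form (shadowRow w β) x b = form β x b := by
  unfold form shadowRow
  simp [hb]

/-- `fires` splits along any predicate on the rows. -/
theorem fires_split (β : Fin N → Fin N → ZMod 3) (c : Fin N → ZMod 3) (R : Finset (Fin N)) (x : Fin N → Bool) (p : Fin N → Prop)
    [DecidablePred p] :
    fires β c R x = fires β c (R.filter p) x + fires β c (R.filter fun g => ¬ p g) x := by
  unfold fires
  rw [filter_filter, filter_filter, ← card_filter_add_card_filter_not (s := R.filter fun g => form β x g = c g) p,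
    filter_filter, filter_filter]
  congr 1
  · congr 1; exact filter_congr fun g _ => by tauto
  · congr 1; exact filter_congr fun g _ => by tauto

/-- The shadow's wide active rows all fire. -/
theorem fires_shadow_wide (w : ℕ) (β : Fin N → Fin N → ZMod 3) (c : Fin N → ZMod 3) (x : Fin N → Bool) :
    fires (shadowRow w β) (shadowOff w β c) (wideAct w β x) x = (wideAct w β x).card := by
  unfold fires
  congr 1
  apply filter_true_of_mem
  intro g hg
  rw [wideAct, mem_filter] at hg
  rw [form_shadow_wide w β x hg.2, shadowOff, if_pos hg.2]

/-- On narrow rows the shadow fires exactly when `β` does. -/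
theorem fires_shadow_narrow (w : ℕ) (β : Fin N → Fin N → ZMod 3) (c : Fin N → ZMod 3) (x : Fin N → Bool) :
    fires (shadowRow w β) (shadowOff w β c) ((act x).filter fun g => ¬ w < (rowSupp β g).card) x
      = fires β c ((act x).filter fun g => ¬ w < (rowSupp β g).card) x := by
  unfold fires
  congr 1
  apply filter_congr
  intro g hg
  rw [mem_filter] at hg
  rw [form_shadow_narrow w β x hg.2, shadowOff, if_neg hg.2]

/-- **SHADOW, POINTWISE (PROVED).** Where the wide active rows fire with parity `≡` their number, `(β, c)` and its `w`-shadow win together. -/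
theorem shadow_pointwise (hN : 3 ≤ N) (w : ℕ) (β : Fin N → Fin N → ZMod 3) (c : Fin N → ZMod 3) {x : Fin N → Bool} (hx : IsOdd x)
    (h : WideParityAt w β c x) :
    RingHLF.Rel x (affBell β c x) ↔ RingHLF.Rel x (affBell (shadowRow w β) (shadowOff w β c) x) := by
  have h1 := targetFormula N hN x hx (affBell β c x)
  have h2 := targetFormula N hN x hx (affBell (shadowRow w β) (shadowOff w β c) x)
  rw [activeOnes_affBell β c rfl] at h1
  rw [activeOnes_affBell (shadowRow w β) (shadowOff w β c) rfl] at h2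
  have hs1 := fires_split β c (act x) x (fun g => w < (rowSupp β g).card)
  have hs2 := fires_split (shadowRow w β) (shadowOff w β c) (act x) x (fun g => w < (rowSupp β g).card)
  have hw := fires_shadow_wide w β c x
  have hn := fires_shadow_narrow w β c x
  unfold WideParityAt at h
  unfold wideAct at h hw
  rw [h1, h2, hs1, hs2, hw, hn]
  constructor <;> intro hh <;> omega

/-- **SHADOW COUNT (PROVED).** `affWinCard β c ≤ affWinCard (shadow) + #{x odd : ¬ WideParityAt w β c x}`. -/
theorem shadow_count (hN : 3 ≤ N) (w : ℕ) (β : Fin N → Fin N → ZMod 3) (c : Fin N → ZMod 3) :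
    affWinCard β c ≤ affWinCard (shadowRow w β) (shadowOff w β c)
      + (univ.filter fun x : Fin N → Bool => IsOdd x ∧ ¬ WideParityAt w β c x).card := by
  unfold affWinCard
  refine le_trans (card_le_card ?_) (card_union_le _ _)
  intro x hx
  rw [mem_filter] at hx
  rw [mem_union, mem_filter, mem_filter]
  have hodd : IsOdd x := (isOdd_iff_oddZeros x).2 hx.2.1
  by_cases hW : WideParityAt w β c x
  · exact Or.inl ⟨mem_univ _, hx.2.1, (shadow_pointwise hN w β c hodd hW).1 hx.2.2⟩
  · exact Or.inr ⟨mem_univ _, hodd, hW⟩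

/-! ### §S.2 The shadow is a log-junta strategy, and log-junta strategies lose a constant fraction (tree: `ringHardOddCond2`) -/

/-- `affBell β c · b` reads only the support of row `b`. -/
theorem readsOnly_affBell (β : Fin N → Fin N → ZMod 3) (c : Fin N → ZMod 3) (b : Fin N) :
    AffBells22.ReadsOnly (rowSupp β b) (fun x => affBell β c x b) := by
  intro x x' h
  have hf : form β x b = form β x' b := by
    unfold form
    refine sum_congr rfl fun i _ => ?_
    by_cases hβ : β b i = 0
    · simp [hβ]
    · have hi : i ∈ rowSupp β b := by rw [rowSupp, mem_filter]; exact ⟨mem_univ _, hβ⟩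
      rw [h i hi]
  rw [Bool.eq_iff_iff, affBell_eq_true_iff, affBell_eq_true_iff, hf]

/-- The junta sets of the shadow: `∅` for wide rows, the support for narrow rows; all of size `≤ w`. -/
def shadowReads (w : ℕ) (β : Fin N → Fin N → ZMod 3) (b : Fin N) : Finset (Fin N) :=
  if w < (rowSupp β b).card then ∅ else rowSupp β b

/-- Auxiliary `card_shadowReads_le` of the frame-shadow reduction (planner qa-qnc0-p1 g29, `Shadow29.lean`, verbatim). -/
theorem card_shadowReads_le (w : ℕ) (β : Fin N → Fin N → ZMod 3) (b : Fin N) : (shadowReads w β b).card ≤ w := by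
  unfold shadowReads
  by_cases h : w < (rowSupp β b).card
  · simp [h]
  · rw [if_neg h]; exact not_lt.mp h

/-- Auxiliary `readsOnly_shadow` of the frame-shadow reduction (planner qa-qnc0-p1 g29, `Shadow29.lean`, verbatim). -/
theorem readsOnly_shadow (w : ℕ) (β : Fin N → Fin N → ZMod 3) (c : Fin N → ZMod 3) (b : Fin N) :
    AffBells22.ReadsOnly (shadowReads w β b) (fun x => affBell (shadowRow w β) (shadowOff w β c) x b) := by
  intro x x' h
  by_cases hb : w < (rowSupp β b).card
  · rw [Bool.eq_iff_iff, affBell_eq_true_iff, affBell_eq_true_iff, form_shadow_wide w β x hb, form_shadow_wide w β x' hb]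
  · have hr : shadowReads w β b = rowSupp β b := by rw [shadowReads, if_neg hb]
    rw [hr] at h
    have := readsOnly_affBell β c b x x' h
    rw [Bool.eq_iff_iff, affBell_eq_true_iff, affBell_eq_true_iff] at this
    rw [Bool.eq_iff_iff, affBell_eq_true_iff, affBell_eq_true_iff, form_shadow_narrow w β x hb, form_shadow_narrow w β x' hb,
      shadowOff, if_neg hb]
    exact this

/-- Auxiliary `subcubeMerge_empty` of the frame-shadow reduction (planner qa-qnc0-p1 g29, `Shadow29.lean`, verbatim). -/
theorem subcubeMerge_empty (a u : Fin N → Bool) : AffBells22.subcubeMerge ∅ a u = u := by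
  funext i
  simp [AffBells22.subcubeMerge]

/-- **LOG-JUNTA HARDNESS (PROVED from the tree's `ringHardOddCond2`, δ₀ = 0, degree exponent 2).** One absolute `θ < 1`: for every `C`,
for `N ≥ n₀(C)`, a strategy whose `k`-th output reads only a set `T_k` of `≤ C·log₂ N` inputs wins on at most `θ·2^{N−1}` odd inputs. -/
theorem juntaLogHard : ∃ θ : ℝ, θ < 1 ∧ ∀ C : ℕ, ∃ n₀ : ℕ, ∀ N ≥ n₀,
    ∀ (T : Fin N → Finset (Fin N)) (g : Fin N → (Fin N → Bool) → Bool),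
      (∀ k, (T k).card ≤ C * Nat.log 2 N) → (∀ k, AffBells22.ReadsOnly (T k) (g k)) →
        (AffBells22.winCount (fun x k => g k x) : ℝ) ≤ θ * (2 : ℝ) ^ (N - 1) := by
  obtain ⟨θ, hθ, hall⟩ := ringHardOddCond2 (δ₀ := 0) (by norm_num)
  refine ⟨θ, hθ, fun C => ?_⟩
  obtain ⟨n₀, hn₀⟩ := hall 2
  refine ⟨max n₀ (2 ^ C), fun N hN T g hT hread => ?_⟩
  have hNn₀ : n₀ ≤ N := le_trans (le_max_left _ _) hN
  have hlog : C ≤ Nat.log 2 N := Nat.le_log_of_pow_le (by norm_num) (le_trans (le_max_right _ _) hN)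
  have hdegle : C * Nat.log 2 N ≤ (Nat.log 2 N) ^ 2 := by
    rw [sq]; exact Nat.mul_le_mul_right _ hlog
  set P : Fin N → CubeFn (ZMod 2) N := fun k x => if g k x then 1 else 0 with hP
  have hdeg : ∀ (a : Fin N → Bool) (k : Fin N),
      (fun x => P k (AffBells22.subcubeMerge ∅ a x)) ∈ lowDeg (ZMod 2) N ((Nat.log 2 N) ^ 2) := by
    intro a k
    have hfun : (fun x => P k (AffBells22.subcubeMerge ∅ a x)) = fun x => if g k x then (1 : ZMod 2) else 0 := by
      funext x; rw [subcubeMerge_empty]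
    rw [hfun]
    exact lowDeg_mono (le_trans (hT k) hdegle) (AffBells22.indicator_mem_lowDeg (T k) _ (hread k))
  have hW : ((∅ : Finset (Fin N)).card : ℝ) ≤ 0 * N := by simp
  have h := hn₀ N hNn₀ ∅ P hW hdeg
  have hfun : ∀ x : Fin N → Bool, (fun i => decide (P i x = 1)) = fun k => g k x := by
    intro x
    funext k
    simp only [hP]
    by_cases hgk : g k x = true
    · simp [hgk]
    · simp [hgk]
  have hset : ((univ : Finset (Fin N → Bool)).filter fun x => OddZeros x ∧ Rel x (fun k => g k x))
      = (univ : Finset (Fin N → Bool)).filter fun x => OddZeros x ∧ Rel x (fun i => decide (P i x = 1)) := by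
    ext x
    simp only [mem_filter, hfun x]
  unfold AffBells22.winCount
  rw [hset]
  exact h

/-- `affWinCard` is `winCount` of the bell strategy. -/
theorem affWinCard_eq_winCount (β : Fin N → Fin N → ZMod 3) (c : Fin N → ZMod 3) :
    affWinCard β c = AffBells22.winCount (fun x k => affBell β c x k) := rfl

/-- **THE SHADOW LOSES (PROVED).** One absolute `θ < 1`: for every `C` and `N ≥ n₀(C)`, every `w ≤ C·log₂ N`, the `w`-shadow of ANY
`(β, c)` wins on at most `θ·2^{N−1}` odd inputs. -/
theorem shadow_loses : ∃ θ : ℝ, θ < 1 ∧ ∀ C : ℕ, ∃ n₀ : ℕ, ∀ N ≥ n₀, ∀ (β : Fin N → Fin N → ZMod 3) (c : Fin N → ZMod 3) (w : ℕ),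
    w ≤ C * Nat.log 2 N → (affWinCard (shadowRow w β) (shadowOff w β c) : ℝ) ≤ θ * (2 : ℝ) ^ (N - 1) := by
  obtain ⟨θ, hθ, hall⟩ := juntaLogHard
  refine ⟨θ, hθ, fun C => ?_⟩
  obtain ⟨n₀, hn₀⟩ := hall C
  refine ⟨n₀, fun N hN β c w hw => ?_⟩
  rw [affWinCard_eq_winCount]
  exact hn₀ N hN (shadowReads w β) (fun k x => affBell (shadowRow w β) (shadowOff w β c) x k)
    (fun k => le_trans (card_shadowReads_le w β k) hw) (fun k => readsOnly_shadow w β c k)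

/-- **SHADOW BOUND (PROVED)** = `shadow_count` + `shadow_loses`: for EVERY affine strategy,
`affWinCard β c ≤ θ·2^{N−1} + #{x odd : ¬ WideParityAt w β c x}` (`w ≤ C log₂ N`, `N ≥ n₀(C)`, one absolute `θ < 1`). -/
theorem shadow_bound : ∃ θ : ℝ, θ < 1 ∧ ∀ C : ℕ, ∃ n₀ : ℕ, ∀ N ≥ n₀, 3 ≤ N → ∀ (β : Fin N → Fin N → ZMod 3) (c : Fin N → ZMod 3) (w : ℕ),
    w ≤ C * Nat.log 2 N →
      (affWinCard β c : ℝ) ≤ θ * (2 : ℝ) ^ (N - 1) + ((univ.filter fun x : Fin N → Bool => IsOdd x ∧ ¬ WideParityAt w β c x).card : ℝ) := by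
  obtain ⟨θ, hθ, hall⟩ := shadow_loses
  refine ⟨θ, hθ, fun C => ?_⟩
  obtain ⟨n₀, hn₀⟩ := hall C
  refine ⟨n₀, fun N hN h3 β c w hw => ?_⟩
  have h1 := shadow_count h3 w β c
  have h2 := hn₀ N hN β c w hw
  calc (affWinCard β c : ℝ) ≤ (affWinCard (shadowRow w β) (shadowOff w β c) : ℝ)
        + ((univ.filter fun x : Fin N → Bool => IsOdd x ∧ ¬ WideParityAt w β c x).card : ℝ) := by exact_mod_cast h1
    _ ≤ _ := by linarith

/-! ### §S.3 The remaining conjecture, typed: `HWide` -/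

/-- Odd points with a WIN-CHANGING coin-pair flip (= a cube witness at some 2-window, `AffBells29.cubeWitness_pair_iff`, Expansion29):
the complement of the window-pure points.  Regime I of ROUND-28 §6 is «many of these» (then `(β, c)` loses `≥ #/N²`, double count). -/
def cutPoints (β : Fin N → Fin N → ZMod 3) (c : Fin N → ZMod 3) : Finset (Fin N → Bool) :=
  univ.filter fun x => IsOdd x ∧ ∃ i ∈ klineZeros x, ∃ j ∈ klineZeros x, i ≠ j ∧
    ¬ (RingHLF.Rel x (affBell β c x) ↔ RingHLF.Rel (flipAt x {i, j}) (affBell β c (flipAt x {i, j})))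

/-- **`HWide`** — THE REMAINING CONJECTURE of the (NP₁) programme after ROUND-28 (regime II), in its weakest usable form: for affine
strategies FAR from frames whose win indicator is invariant under all but a `N^{-a}` fraction of coin-pair flips (few cut points), WIDE PARITY
(`WideParityAt (C·log₂ N)`) fails on only an `ε`-fraction of the odd class — for every `ε > 0`, with `C, a, n₀` allowed to depend on `ε`.
With `shadow_bound` this bounds regime II by `(θ + ε)·2^{N−1}`; with the cut-point double count (regime I, §S.4) and `AffBells27.affFrameLoss`
(frames) it gives `AffBellsPolyLoss3` (`polyLoss_of_hWide`, §S.5, PROVED).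
Why it might fail: an exotic far family, window-pure at almost every point, whose wide classes are UNBALANCED (or which has non-firing blind wide
rows) at a constant fraction of points — none known: run-local designs are twin-only for run length ≤ 4 exhaustively (K-40), G2-clusters die under
single deletions, blind wide rows are `N^{1−cC}`-rare (ROUND-28 §6(b), §6A).
**[REFUTED AS TYPED — qn-p1 g30 A-30b / R3 (2026-08-28T20:35Z), lit K-45/K-46: every THRESHOLD-defined wide set is refuted (width ladders /
neighbour sandwiches / RT₆⋆ tilings straddle any `w ≤ C·log₂N`); `HWide`, `HShape` (`AffBells29Shape`), `AffBells30.HWideE`/`HCert` are kept as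
labelled records.  LIVE: `AffBells29.HAbs` (`AffBells29Transfer`, `polyLoss_of_hAbs` PROVED) and its refinements `AffBells30.HDrop` /
`HBlock` (HOME/qa-qnc0-p1/exp30/Cert30.lean, ROUND-29).]** -/
def HWide : Prop :=
  ∃ δ₀ : ℝ, δ₀ < 1 / 2 ∧ ∃ r₀ w₀ : ℕ, ∀ ε : ℝ, 0 < ε → ∃ C a n₀ : ℕ, ∀ N ≥ n₀, ∀ (β : Fin N → Fin N → ZMod 3) (c : Fin N → ZMod 3),
    ¬ FrameDecomp δ₀ r₀ w₀ β →
    ((cutPoints β c).card : ℝ) ≤ (2 : ℝ) ^ (N - 1) / (N : ℝ) ^ a →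
      (((univ.filter fun x : Fin N → Bool => IsOdd x ∧ ¬ WideParityAt (C * Nat.log 2 N) β c x).card : ℝ) ≤ ε * (2 : ℝ) ^ (N - 1))


end AffBells29

end Summit.QuantumAdvantage.AdviceFreeQNC0
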